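import Summits.MatrixMultiplication.MatrixMultiplication.Theses.CubicExchangeSplit
import Summits.MatrixMultiplication.MatrixMultiplication.Theorems.CubicAmortisation.Negative.LoadBearing
import Literature.Computability.AlgebraicComplexity.RectangularExponentAsymptoticRank
import Literature.Computability.AlgebraicComplexity.AsymptoticSpectrumDuality
import Literature.Computability.AlgebraicComplexity.BigCwFourthOmega
import Literature.Barriers.MatrixMultiplication.RectangularBarrier

/-!
# Crux `CubicAmortisation` (stmt-MatrixMultiplication-18000) — `Lines/birth.lean` (BC3 birth skeleton)

Route `CubicExchangeSplit`, crux #2 `CubicAmortisation` = E₃, perfect cubic amortisation: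
`∀ ε > 0, R(⟨n,n,n³⟩) = O(n^{4+ε})` (`R = tensorRank ∘ matMulTensor ℂ`), i.e. `ω(1,1,3) = 4`.

## Why not the route header's Carrier → Soundness skeleton

The route's TWO-LAYER PLAN (rev 1) proposed `stub_carrier` (a tensor `T` with a `T`-method bound
`ω̂(1,1,3) ≤ 4 + η`, `IsTMethodBound`) and `stub_sound` (CLLZ Thm 2.1 at `p = 3`).  Since then the tree
PROVED CLLZ Thm 2.1 (`Literature.Barriers.MatrixMultiplication.CLLZ2025_tMethodBound_sound_holds`), so
`stub_sound` would be in-tree and `stub_carrier` alone would give the crux: that skeleton is now a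
one-stub costume and is NOT registered.

## The line registered here: SPECTRAL LOCALISATION ("NearFace")

Everything below except the two stubs is proved.  By the tree's `asymptoticRank_matMulTensor_rect`
(`R̃(⟨q^a,q^b,q^c⟩) = q^{ω(a,b,c)}`, ADVXXZ 2025 §3.4, proved) and Strassen duality
(`strassen_duality_asymptoticRank_holds`, proved), the crux is equivalent to

  `R̃(⟨2,2,8⟩) ≤ 16`  ⟺  every universal spectral point `F` (CVZ 2023 §1.2) has `F(⟨2,2,8⟩) ≤ 16`

(`spectralBound_of_cubicAmortisation` / `cubicAmortisation_of_spectralBound` below; `16 = 2·8` is the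
flattening rank, so this is the asymptotic rank conjecture for the single tensor `⟨2,2,8⟩ ∈ ℂ⁴ ⊗ ℂ¹⁶ ⊗ ℂ¹⁶`).
For a universal `F` write `e_F := F(⟨1,1,2⟩) ∈ [1,2]`, its value on the EPR pair of the LONG leg.
Multiplicativity and the block isomorphism `⟨2,2,8⟩ ≅ ⟨2,2,2⟩ ⊗ ⟨1,1,2⟩ ⊗ ⟨1,1,2⟩` give
`F(⟨2,2,8⟩) = F(⟨2,2,2⟩) · e_F²` (`map_matMul_228`, proved), and `F(⟨2,2,2⟩) ≤ R̃(⟨2,2,2⟩) = 2^ω`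
(duality + `asymptoticRank_matMulTensor`).  Hence with the tree's PROVED `ω ≤ 2.37295`
(`LeGall2014_cw4_omega_le`) every spectral point with `e_F ≤ 7/4` already satisfies the bound
(`2^{2.37295}·49/16 ≤ 2^{19/8}·49/16 ≤ 16`, an integer check `2¹⁹·49⁸ ≤ 256⁸`): that is
`stub_farFromFace` (PROVABLE NOW, size S/M).  What is left — `stub_nearFace` (OPEN, load-bearing) — is
the crux LOCALISED to the spectral points within `log₂(8/7) ≈ 0.193` of SATURATING the long EPR leg
(`e_F > 7/4`): a violator of E₃ must almost saturate `⟨1,1,2⟩` while keeping `F(⟨2,2,2⟩) > 16/e_F² ≥ 4`,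
i.e. it is an `ω`-excess point sitting next to the EPR face — the regime of EPRFaces' `FaceMaximiser`
and of the exchange crux `CubicExchange` of this route.  In exponent coordinates
(`u,v,w = log₂ F⟨2,1,1⟩, F⟨1,2,1⟩, F⟨1,1,2⟩`): E₃ ⟺ `u + v + 3w ≤ 4` on the spectrum, `ω = 2` ⟺
`u + v + w ≤ 2`; the far region `w ≤ log₂(7/4)` is settled by `u+v+w ≤ ω ≤ 2.37295`.

HONEST STATUS.  Given `stub_farFromFace` (provable), `stub_nearFace` is EQUIVALENT to the crux
(`rankBound_of_parts` one way, `nearFace_of_cubicAmortisation` the other, both sorry-free): the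
skeleton is a localisation of the difficulty (which spectral points can violate E₃), not a weakening of
it.  Raising the threshold `7/4` requires a better PROVED bound on `ω` (threshold `4·2^{-ω₀/2}`:
`ω₀ = 2.37295 ↦ 1.7575`); at `ω₀ = 2` the near region is the single face `e_F = 2`.

Composition: `rankBound_of_parts : (far) → (near) → <the crux's rank form>` (real proof: case split on
`e_F ≤ 7/4`, Strassen duality, `R̃(⟨2,2,8⟩) = 2^{ω(1,1,3)}`, and the rank-form dictionary
`rankBound_of_omegaRect_le`), and the skeleton theorem `CubicAmortisation_of : CubicAmortisation :=
rankBound_of_parts stub_farFromFace stub_nearFace` (the crux BY NAME; the only theorem here concluding it).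
The dictionary uses `0 < ε` — the line honours
`Theorems.CubicAmortisation.Negative.cubicAmortisation_false_without_pos`; the tightness lemma
`not_isBigO_rank_cubic_of_lt_four` is used in the converse dictionary).  Sorries: exactly the two stubs.
Disproof.lean: none exists for this crux (`ledger crux ls stmt-MatrixMultiplication-18000`, 2026-08-17: no
workfiles); Negative lemmas: `Theorems/CubicAmortisation/Negative/LoadBearing.lean` (imported, respected).
-/

set_option linter.dupNamespace false

namespace Summit.MatrixMultiplication.MatrixMultiplication.Cruxes.CubicAmortisation.Birth

open Summit.MatrixMultiplication.MatrixMultiplication.Theses.CubicExchangeSplit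
open Summit.MatrixMultiplication.MatrixMultiplication.Theorems.CubicAmortisation.Negative
open Literature.Computability.AlgebraicComplexity
open Filter Asymptotics

/-! ## The two registered stubs -/

/-- STUB 1 (PROVABLE NOW, size S/M) — FAR FROM THE EPR FACE: a universal spectral point whose value on
the long-leg EPR pair `⟨1,1,2⟩` is at most `7/4` satisfies the cubic amortisation inequality
`F(⟨2,2,8⟩) ≤ 16`.  Plan: `F(⟨2,2,8⟩) = F(⟨2,2,2⟩)·F(⟨1,1,2⟩)²` (`map_matMul_228` below),
`F(⟨2,2,2⟩) ≤ R̃(⟨2,2,2⟩) = 2^ω` (`strassen_duality_asymptoticRank_holds`, `asymptoticRank_matMulTensor`),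
`ω ≤ 2.37295 ≤ 19/8` (`LeGall2014_cw4_omega_le`), and `2^{19/8}·(7/4)² ≤ 16` from `2¹⁹·49⁸ ≤ 256⁸`
(`norm_num`).  Why plausibly true: it is a theorem modulo this bookkeeping. -/
theorem stub_farFromFace :
    ∀ F : SpectralMap ℂ, IsUniversalSpectralPoint ℂ F →
      F (matMulTensor ℂ 1 1 2) ≤ 7 / 4 → F (matMulTensor ℂ 2 2 8) ≤ 16 := by
  sorry

/-- STUB 2 (OPEN, load-bearing — the lead's stub) — NEAR THE EPR FACE: a universal spectral point within
`log₂(8/7)` of saturating the long-leg EPR pair (`F(⟨1,1,2⟩) > 7/4`, the maximum being `R(⟨1,1,2⟩) = 2`)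
satisfies `F(⟨2,2,8⟩) ≤ 16`, i.e. `F(⟨2,2,2⟩) ≤ 16 / F(⟨1,1,2⟩)²`: an `ω`-excess spectral point cannot
sit next to the EPR face of the long leg.  Equivalent to the crux given `stub_farFromFace`
(`rankBound_of_parts`, `nearFace_of_cubicAmortisation`).  Non-vacuous: the maximal spectral point of
`⟨1,1,2⟩` (duality, `R̃(⟨1,1,2⟩) = 2^{ω(0,0,1)} = 2`) and the gauge points of the two non-trivial legs of
`⟨1,1,2⟩` (flattening ranks `2`; CVZ Ex. 1.4) have `F(⟨1,1,2⟩) = 2`, and for them `F(⟨2,2,8⟩) = 16` exactly —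
the stub is TIGHT on the face.  Why it might fail: exactly if `ω(1,1,3) > 4`, i.e. some universal spectral
point has `u + v + 3w > 4` (then necessarily `w > log₂(7/4)`). -/
theorem stub_nearFace :
    ∀ F : SpectralMap ℂ, IsUniversalSpectralPoint ℂ F →
      7 / 4 < F (matMulTensor ℂ 1 1 2) → F (matMulTensor ℂ 2 2 8) ≤ 16 := by
  sorry

/-! ## Glue, part 1 (real proofs): the rank-form ⟷ exponent-form dictionary at the format `(1,1,3)` -/

/-- The admissible exponents of `ω(1,1,3)` (`rectAdmissibleExponents ℂ 1 1 3`, stated with `⌈n^1⌉, ⌈n^3⌉`)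
are exactly the `β` with `R(⟨n,n,n³⟩) = O(n^β)` — the crux's rank form (`rectDim_one`, `rectDim_natCast`). -/
theorem mem_rectAdmissibleExponents_113_iff (β : ℝ) :
    β ∈ rectAdmissibleExponents ℂ 1 1 3 ↔
      (fun n : ℕ => (tensorRank (matMulTensor ℂ n n (n ^ 3)) : ℝ)) =O[atTop]
        (fun n : ℕ => (n : ℝ) ^ β) := by
  have hfun : (fun n : ℕ =>
      (tensorRank (matMulTensor ℂ (rectDim n 1) (rectDim n 1) (rectDim n 3)) : ℝ)) =
      fun n : ℕ => (tensorRank (matMulTensor ℂ n n (n ^ 3)) : ℝ) := by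
    funext n
    have h3 : rectDim n 3 = n ^ 3 := by
      rw [show (3 : ℝ) = ((3 : ℕ) : ℝ) by norm_num]
      exact rectDim_natCast n 3
    rw [tensorRank_matMulTensor_congr ℂ (rectDim_one n) (rectDim_one n) h3]
  simp only [rectAdmissibleExponents, Set.mem_setOf_eq, hfun]

/-- DICTIONARY, the direction the line uses: `ω(1,1,3) ≤ 4 ⟹` the crux's rank form (the BODY of
`CubicAmortisation`, verbatim — `Theorems.CubicAmortisation.Negative.crux_iff` is `Iff.rfl`; stated unfolded so
that `CubicAmortisation_of` below is the ONLY theorem of this file concluding the crux by name).  For `ε > 0`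
some admissible `β < ω(1,1,3) + ε ≤ 4 + ε` exists (`Real.lt_sInf_add_pos`), and admissibility is upward
closed.  The hypothesis `0 < ε` of the crux is used here (cf. `cubicAmortisation_false_without_pos`). -/
theorem rankBound_of_omegaRect_le (h : omegaRect ℂ 1 1 3 ≤ 4) :
    ∀ ε : ℝ, 0 < ε → (fun n : ℕ => (tensorRank (matMulTensor ℂ n n (n ^ 3)) : ℝ)) =O[atTop]
      (fun n : ℕ => (n : ℝ) ^ ((4 : ℝ) + ε)) := by
  intro ε hε
  obtain ⟨β, hβ, hlt⟩ := Real.lt_sInf_add_pos (rectAdmissibleExponents_nonempty ℂ 1 1 3) hε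
  have hle : β ≤ 4 + ε := by
    have hinf : sInf (rectAdmissibleExponents ℂ 1 1 3) = omegaRect ℂ 1 1 3 := rfl
    linarith
  exact (mem_rectAdmissibleExponents_113_iff _).1 (mem_rectAdmissibleExponents_of_le hβ hle)

/-- DICTIONARY, converse (sorry-free honesty check): `CubicAmortisation ⟹ ω(1,1,3) ≤ 4`.  The admissible
set is bounded below by `4` (tightness lemma `not_isBigO_rank_cubic_of_lt_four` of the Negative lane), so
`csInf_le` applies to the admissible exponents `4 + δ/2`. -/
theorem omegaRect_le_of_cubicAmortisation (h : CubicAmortisation) : omegaRect ℂ 1 1 3 ≤ 4 := by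
  have hbdd : BddBelow (rectAdmissibleExponents ℂ 1 1 3) := by
    refine ⟨4, fun β hβ => ?_⟩
    by_contra hlt
    rw [not_le] at hlt
    exact not_isBigO_rank_cubic_of_lt_four hlt ((mem_rectAdmissibleExponents_113_iff β).1 hβ)
  refine le_of_forall_pos_lt_add fun δ hδ => ?_
  have hmem : 4 + δ / 2 ∈ rectAdmissibleExponents ℂ 1 1 3 :=
    (mem_rectAdmissibleExponents_113_iff _).2 (h (δ / 2) (by positivity))
  have hinf : omegaRect ℂ 1 1 3 ≤ 4 + δ / 2 := csInf_le hbdd hmem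
  linarith

/-! ## Glue, part 2 (real proofs): Strassen duality and `R̃(⟨2,2,8⟩) = 2^{ω(1,1,3)}` -/

/-- `(2 : ℝ) ^ (4 : ℝ) = 16`. -/
theorem two_rpow_four : (2 : ℝ) ^ (4 : ℝ) = 16 := by
  rw [show (4 : ℝ) = ((4 : ℕ) : ℝ) by norm_num, Real.rpow_natCast]
  norm_num

/-- SPECTRAL BOUND ⟹ `ω(1,1,3) ≤ 4`: if every universal spectral point has `F(⟨2,2,8⟩) ≤ 16` then, by
Strassen duality (`strassen_duality_asymptoticRank_holds`, proved in tree), `R̃(⟨2,2,8⟩) ≤ 16 = 2⁴`, and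
`R̃(⟨2¹,2¹,2³⟩) = 2^{ω(1,1,3)}` (`asymptoticRank_matMulTensor_rect`, proved in tree) gives `ω(1,1,3) ≤ 4`. -/
theorem omegaRect_le_of_spectralBound
    (h : ∀ F : SpectralMap ℂ, IsUniversalSpectralPoint ℂ F → F (matMulTensor ℂ 2 2 8) ≤ 16) :
    omegaRect ℂ 1 1 3 ≤ 4 := by
  have hR : asymptoticRank (matMulTensor ℂ (2 ^ 1) (2 ^ 1) (2 ^ 3)) ≤ 16 := by
    refine strassen_duality_asymptoticRank.asymptoticRank_le (strassen_duality_asymptoticRank_holds ℂ) _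
      fun F hF => ?_
    rw [SpectralMap.map_matMulTensor_congr F (show 2 ^ 1 = 2 by norm_num) (show 2 ^ 1 = 2 by norm_num)
      (show 2 ^ 3 = 8 by norm_num)]
    exact h F hF
  rw [asymptoticRank_matMulTensor_rect ℂ (le_refl 2) 1 1 3] at hR
  push_cast at hR
  rw [← two_rpow_four] at hR
  exact (Real.rpow_le_rpow_left_iff (by norm_num : (1 : ℝ) < 2)).1 hR

/-- `CubicAmortisation ⟹ SPECTRAL BOUND` (sorry-free converse): every universal spectral point has
`F(⟨2,2,8⟩) ≤ R̃(⟨2,2,8⟩) = 2^{ω(1,1,3)} ≤ 2⁴`. -/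
theorem spectralBound_of_cubicAmortisation (h : CubicAmortisation) :
    ∀ F : SpectralMap ℂ, IsUniversalSpectralPoint ℂ F → F (matMulTensor ℂ 2 2 8) ≤ 16 := by
  intro F hF
  have hω := omegaRect_le_of_cubicAmortisation h
  have hR : asymptoticRank (matMulTensor ℂ (2 ^ 1) (2 ^ 1) (2 ^ 3)) ≤ 16 := by
    rw [asymptoticRank_matMulTensor_rect ℂ (le_refl 2) 1 1 3]
    push_cast
    rw [← two_rpow_four]
    exact Real.rpow_le_rpow_of_exponent_le (by norm_num) hω
  have hF' := (strassen_duality_asymptoticRank_holds ℂ (matMulTensor ℂ (2 ^ 1) (2 ^ 1) (2 ^ 3))).1 F hF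
  rw [SpectralMap.map_matMulTensor_congr F (show 2 ^ 1 = 2 by norm_num) (show 2 ^ 1 = 2 by norm_num)
    (show 2 ^ 3 = 8 by norm_num)] at hF'
  exact hF'.trans hR

/-- The crux in spectral form (both directions proved): `CubicAmortisation ⟺ ∀ universal F, F(⟨2,2,8⟩) ≤ 16`
— the asymptotic rank conjecture for the tensor `⟨2,2,8⟩`. -/
theorem cubicAmortisation_iff_spectralBound :
    CubicAmortisation ↔
      ∀ F : SpectralMap ℂ, IsUniversalSpectralPoint ℂ F → F (matMulTensor ℂ 2 2 8) ≤ 16 :=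
  ⟨spectralBound_of_cubicAmortisation,
    fun h => rankBound_of_omegaRect_le (omegaRect_le_of_spectralBound h)⟩

/-! ## Glue, part 3 (real proofs): multiplicativity on block formats — the arithmetic behind the split -/

/-- `F(⟨l₁l₂, m₁m₂, n₁n₂⟩) = F(⟨l₁,m₁,n₁⟩) · F(⟨l₂,m₂,n₂⟩)` for a universal spectral point: the block
isomorphism `⟨l₁,m₁,n₁⟩ ⊗ ⟨l₂,m₂,n₂⟩ ≅ ⟨l₁l₂,m₁m₂,n₁n₂⟩` (tree, both restrictions) and multiplicativity. -/
theorem map_matMul_mul {F : SpectralMap ℂ} (hF : IsUniversalSpectralPoint ℂ F)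
    (l₁ l₂ m₁ m₂ n₁ n₂ : ℕ) :
    F (matMulTensor ℂ (l₁ * l₂) (m₁ * m₂) (n₁ * n₂)) =
      F (matMulTensor ℂ l₁ m₁ n₁) * F (matMulTensor ℂ l₂ m₂ n₂) := by
  have hk := hF.map_kronecker (matMulTensor ℂ l₁ m₁ n₁) (matMulTensor ℂ l₂ m₂ n₂)
  rw [← hk]
  exact hF.eq_of_restrictsTo
    (Literature.Barriers.MatrixMultiplication.tensorRestrictsTo_kronecker_matMul_matMul l₁ l₂ m₁ m₂ n₁ n₂)
    (Literature.Barriers.MatrixMultiplication.tensorRestrictsTo_matMul_kronecker_matMul l₁ l₂ m₁ m₂ n₁ n₂)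

/-- `F(⟨2,2,8⟩) = F(⟨2,2,2⟩) · F(⟨1,1,2⟩)²` for a universal spectral point (the identity behind both stubs:
`⟨2,2,8⟩ ≅ ⟨2,2,2⟩ ⊗ ⟨1,1,4⟩`, `⟨1,1,4⟩ ≅ ⟨1,1,2⟩ ⊗ ⟨1,1,2⟩`). -/
theorem map_matMul_228 {F : SpectralMap ℂ} (hF : IsUniversalSpectralPoint ℂ F) :
    F (matMulTensor ℂ 2 2 8) = F (matMulTensor ℂ 2 2 2) * F (matMulTensor ℂ 1 1 2) ^ 2 := by
  have h1 : F (matMulTensor ℂ 2 2 8) = F (matMulTensor ℂ 2 2 2) * F (matMulTensor ℂ 1 1 4) := by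
    rw [SpectralMap.map_matMulTensor_congr F (show 2 = 2 * 1 by norm_num) (show 2 = 2 * 1 by norm_num)
      (show 8 = 2 * 4 by norm_num)]
    exact map_matMul_mul hF 2 1 2 1 2 4
  have h2 : F (matMulTensor ℂ 1 1 4) = F (matMulTensor ℂ 1 1 2) * F (matMulTensor ℂ 1 1 2) := by
    rw [SpectralMap.map_matMulTensor_congr F (show 1 = 1 * 1 by norm_num) (show 1 = 1 * 1 by norm_num)
      (show 4 = 2 * 2 by norm_num)]
    exact map_matMul_mul hF 1 1 1 1 2 2
  rw [h1, h2, sq]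

/-- `F(⟨2,2,2⟩) ≤ 2^ω` for a universal spectral point (duality and `R̃(⟨2,2,2⟩) = 2^ω`, both proved in
tree) — the other input of `stub_farFromFace`. -/
theorem map_matMul_222_le {F : SpectralMap ℂ} (hF : IsUniversalSpectralPoint ℂ F) :
    F (matMulTensor ℂ 2 2 2) ≤ (2 : ℝ) ^ omega ℂ := by
  have h := (strassen_duality_asymptoticRank_holds ℂ (matMulTensor ℂ 2 2 2)).1 F hF
  rw [asymptoticRank_matMulTensor ℂ 2 (by norm_num)] at h
  exact_mod_cast h

/-! ## Composition (real proofs): the crux from the two stub STATEMENTS, then BY NAME from the stubs -/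

/-- COMPOSITION WITH THE STUB STATEMENTS AS HYPOTHESES (real proof, sorry-free): FAR → NEAR → the crux's
rank form (= `CubicAmortisation` unfolded, `crux_iff`).  Case split on `F(⟨1,1,2⟩) ≤ 7/4` gives the spectral
bound at `⟨2,2,8⟩` for every universal spectral point; Strassen duality, `R̃(⟨2,2,8⟩) = 2^{ω(1,1,3)}` and the
rank-form dictionary finish. -/
theorem rankBound_of_parts :
    (∀ F : SpectralMap ℂ, IsUniversalSpectralPoint ℂ F →
        F (matMulTensor ℂ 1 1 2) ≤ 7 / 4 → F (matMulTensor ℂ 2 2 8) ≤ 16) →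
    (∀ F : SpectralMap ℂ, IsUniversalSpectralPoint ℂ F →
        7 / 4 < F (matMulTensor ℂ 1 1 2) → F (matMulTensor ℂ 2 2 8) ≤ 16) →
    ∀ ε : ℝ, 0 < ε → (fun n : ℕ => (tensorRank (matMulTensor ℂ n n (n ^ 3)) : ℝ)) =O[atTop]
      (fun n : ℕ => (n : ℝ) ^ ((4 : ℝ) + ε)) := by
  intro hfar hnear
  refine rankBound_of_omegaRect_le (omegaRect_le_of_spectralBound fun F hF => ?_)
  rcases le_or_gt (F (matMulTensor ℂ 1 1 2)) (7 / 4) with hle | hlt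
  · exact hfar F hF hle
  · exact hnear F hF hlt

/-- THE SKELETON THEOREM — the crux BY NAME from the two registered stubs: `CubicAmortisation_of` is
`rankBound_of_parts stub_farFromFace stub_nearFace` read back through `crux_iff` (definitional).  Its only
`sorry`s are the two stubs'; everything else in its closure is proved (axioms of `rankBound_of_parts`:
propext, Classical.choice, Quot.sound). -/
theorem CubicAmortisation_of : CubicAmortisation :=
  rankBound_of_parts stub_farFromFace stub_nearFace

/-- Honesty check (sorry-free): the open stub is implied by the crux, so given `stub_farFromFace` it is the
crux localised to the near-face region — no weaker, no stronger. -/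
theorem nearFace_of_cubicAmortisation (h : CubicAmortisation) :
    ∀ F : SpectralMap ℂ, IsUniversalSpectralPoint ℂ F →
      7 / 4 < F (matMulTensor ℂ 1 1 2) → F (matMulTensor ℂ 2 2 8) ≤ 16 :=
  fun F hF _ => spectralBound_of_cubicAmortisation h F hF

end Summit.MatrixMultiplication.MatrixMultiplication.Cruxes.CubicAmortisation.Birth
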